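import Mathlib

/-!
# SoloBlindZippel — the product-form (Zippel) non-vanishing count (solo-blind, r52Z)

Kernel certificate for the counting step of LEMMA ZP / THEOREM NP of the solo-blind memo
`work/s100/no-planes.md` (no plane on the sextic Dwork fourfold `X₁₀`).

* `zippel` — **product form of the DeMillo–Lipton–Schwartz–Zippel lemma** (Zippel 1979; Schwartz 1980,
  Lemma 1 / Cor. 1): if `p ≠ 0` is a polynomial in `n` variables over an integral domain and
  `S₀, …, S_{n-1}` are finite sets, then at least `∏ᵢ (#Sᵢ - degᵢ p)` points of the grid `∏ᵢ Sᵢ` are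
  NON-zeros of `p` (truncated subtraction).  Mathlib has only the additive upper bounds
  `MvPolynomial.schwartz_zippel_sum_degreeOf` / `_totalDegree` (the fraction of zeros is at most
  `Σᵢ degᵢ p / #Sᵢ`), which are vacuous in the regime of LEMMA ZP (`n = 5`, `#Sᵢ = 6`, `degᵢ ≤ 2`:
  `10/6 > 1`); the product form gives `4⁵ = 1024` non-zeros.  Proof: induction on `n` through
  `MvPolynomial.finSuccEquiv`, exactly as in Mathlib's file, with the univariate root bound
  `Polynomial.card_roots'` in each good fibre.
* `zippel_uniform` — all `#Sᵢ = s`, all `degᵢ p ≤ d`: at least `(s - d)^n` non-zeros.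
* `zippel_six_two_five` — the instance used by LEMMA ZP: `n = 5`, `#S = 6`, `degᵢ ≤ 2` ⇒ `≥ 1024` non-zeros.
* `lt_card_image_of_fibre_le` / `np_translate_count` — pigeonhole through a map with fibres of size `≤ 6`:
  `≥ 1024 > 6·170` good points of `μ₆⁵ ≅ ker(∏) ⊂ μ₆⁶` give `≥ 171` good classes in `G = ker(∏)/μ₆`
  (the `≥ 171` disjoint `G`-translates of a plane in THEOREM NP).

What is NOT certified here (prose in the memo): the geometric inputs CH/3P/MB/ST that make the Plücker
polynomial `ψ_P(t) = (t₁⋯t₅)·det[M; M·D_t]` non-zero with individual degrees `≤ 2`, and the identification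
"`ψ_P(g̃) ≠ 0 ⇔ P ∩ gP = ∅`".
-/

set_option linter.dupNamespace false

namespace Summit.HodgeConjecture.HodgeConjecture.Theorems

namespace SoloBlindZippel

open Fin Finset Fintype MvPolynomial

variable {R : Type*} [CommRing R] [IsDomain R] [DecidableEq R]

/-- Univariate step: a non-zero polynomial `q` has at most `natDegree q` roots in `S`, hence at least
`#S - natDegree q` non-roots in `S`. -/
theorem card_sub_natDegree_le_card_nonroots (q : Polynomial R) (hq : q ≠ 0) (S : Finset R) :
    S.card - q.natDegree ≤ (S.filter fun a => ¬ Polynomial.eval a q = 0).card := by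
  have h1 : (S.filter fun a => Polynomial.eval a q = 0).card ≤ q.natDegree := by
    calc (S.filter fun a => Polynomial.eval a q = 0).card ≤ q.roots.toFinset.card := by
          apply Finset.card_le_card
          intro a ha
          rw [Finset.mem_filter] at ha
          rw [Multiset.mem_toFinset, Polynomial.mem_roots hq]
          exact ha.2
      _ ≤ Multiset.card q.roots := Multiset.toFinset_card_le _
      _ ≤ q.natDegree := Polynomial.card_roots' q
  have h2 := Finset.card_filter_add_card_filter_not
    (s := S) (fun a => Polynomial.eval a q = 0)
  omega

/-- **Zippel's lemma, product form.**  For a non-zero `p : MvPolynomial (Fin n) R` over an integral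
domain and finite sets `S i ⊆ R`, at least `∏ i, (#(S i) - degᵢ p)` points of the grid
`Fintype.piFinset S` are non-zeros of `p`. -/
theorem zippel :
    ∀ {n : ℕ} (p : MvPolynomial (Fin n) R) (_hp : p ≠ 0) (S : Fin n → Finset R),
      ∏ i, ((S i).card - p.degreeOf i) ≤
        ((piFinset S).filter fun x => ¬ eval x p = 0).card
  | 0, p, hp, S => by
      have hc : p.coeff 0 ≠ 0 := by
        intro h
        apply hp
        rw [p.eq_C_of_isEmpty, h, C_0]
      have hmem : (fun i => Fin.elim0 i : Fin 0 → R) ∈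
          ((piFinset S).filter fun x => ¬ eval x p = 0) := by
        rw [Finset.mem_filter, Fintype.mem_piFinset]
        refine ⟨fun i => Fin.elim0 i, ?_⟩
        rw [p.eq_C_of_isEmpty, eval_C]
        exact hc
      rw [Fin.prod_univ_zero]
      exact Nat.one_le_iff_ne_zero.mpr (Finset.card_ne_zero.mpr ⟨_, hmem⟩)
  | n + 1, p, hp, S => by
      -- `p` as a univariate polynomial over polynomials in the last `n` variables
      have hp'₀ : finSuccEquiv R n p ≠ 0 := (EmbeddingLike.map_ne_zero_iff).2 hp
      have hpk₀ : (finSuccEquiv R n p).leadingCoeff ≠ 0 :=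
        Polynomial.leadingCoeff_ne_zero.mpr hp'₀
      -- induction hypothesis for the leading coefficient on the tail grid
      have ih := zippel (finSuccEquiv R n p).leadingCoeff hpk₀ (Fin.tail S)
      -- degrees of the leading coefficient are bounded by those of `p`
      have hdeg : ∀ i : Fin n,
          ((finSuccEquiv R n p).leadingCoeff).degreeOf i ≤ p.degreeOf i.succ := by
        intro i
        rw [Polynomial.leadingCoeff]
        exact degreeOf_coeff_finSuccEquiv p i _
      -- the good tail points
      set G : Finset (Fin n → R) :=
        (piFinset (Fin.tail S)).filter fun t => ¬ eval t (finSuccEquiv R n p).leadingCoeff = 0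
        with hG
      -- the fibre over a tail point
      set F : (Fin n → R) → Finset R :=
        fun t => (S 0).filter fun a => ¬ eval (Fin.cons a t : Fin (n + 1) → R) p = 0 with hF
      -- Step B: every good fibre has at least `#(S 0) - deg₀ p` non-zeros
      have hfib : ∀ t : Fin n → R, ¬ eval t (finSuccEquiv R n p).leadingCoeff = 0 →
          (S 0).card - p.degreeOf 0 ≤ (F t).card := by
        intro t ht
        have hqdeg : (Polynomial.map (eval t) (finSuccEquiv R n p)).natDegree = p.degreeOf 0 := by
          rw [Polynomial.natDegree_map_of_leadingCoeff_ne_zero _ ht, natDegree_finSuccEquiv]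
        have hq₀ : Polynomial.map (eval t) (finSuccEquiv R n p) ≠ 0 := by
          intro h
          apply ht
          rw [Polynomial.leadingCoeff, ← Polynomial.coeff_map, h, Polynomial.coeff_zero]
        have step := card_sub_natDegree_le_card_nonroots _ hq₀ (S 0)
        rw [hqdeg] at step
        have hset : ((S 0).filter fun a =>
              ¬ Polynomial.eval a (Polynomial.map (eval t) (finSuccEquiv R n p)) = 0) = F t := by
          rw [hF]
          apply Finset.filter_congr
          intro a _
          rw [eval_eq_eval_mv_eval']
        rw [hset] at step
        exact step
      -- Step C: assemble the fibres over the good tail points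
      calc ∏ i, ((S i).card - p.degreeOf i)
          = ((S 0).card - p.degreeOf 0) * ∏ i : Fin n, ((S i.succ).card - p.degreeOf i.succ) :=
            Fin.prod_univ_succ _
        _ ≤ ((S 0).card - p.degreeOf 0) *
              ∏ i : Fin n, ((Fin.tail S i).card - ((finSuccEquiv R n p).leadingCoeff).degreeOf i) := by
            apply Nat.mul_le_mul_left
            apply Finset.prod_le_prod (fun i _ => Nat.zero_le _)
            intro i _
            exact Nat.sub_le_sub_left (hdeg i) _
        _ ≤ ((S 0).card - p.degreeOf 0) * G.card := Nat.mul_le_mul_left _ ih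
        _ = G.card * ((S 0).card - p.degreeOf 0) := Nat.mul_comm _ _
        _ ≤ ∑ t ∈ G, (F t).card := by
            have h := Finset.card_nsmul_le_sum G (fun t => (F t).card) ((S 0).card - p.degreeOf 0)
              (fun t ht => hfib t (Finset.mem_filter.mp ht).2)
            simpa [smul_eq_mul] using h
        _ = (G.sigma F).card := (Finset.card_sigma _ _).symm
        _ ≤ ((piFinset S).filter fun x => ¬ eval x p = 0).card := by
            refine Finset.card_le_card_of_injOn (fun x => (Fin.cons x.2 x.1 : Fin (n + 1) → R)) ?_ ?_
            · intro x hx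
              have hx' : x ∈ G.sigma F := by exact_mod_cast hx
              rw [Finset.mem_sigma] at hx'
              obtain ⟨h1, h2⟩ := hx'
              rw [hG, Finset.mem_filter] at h1
              rw [hF, Finset.mem_filter] at h2
              have goal : (Fin.cons x.2 x.1 : Fin (n + 1) → R) ∈
                  ((piFinset S).filter fun x => ¬ eval x p = 0) := by
                rw [Finset.mem_filter, Fin.mem_piFinset_iff_zero_tail, Fin.cons_zero, Fin.tail_cons]
                exact ⟨⟨h2.1, h1.1⟩, h2.2⟩
              exact_mod_cast goal
            · intro x _ y _ hxy
              have h := Fin.cons_injective2 hxy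
              obtain ⟨t, a⟩ := x
              obtain ⟨t', a'⟩ := y
              simp only at h
              obtain ⟨rfl, rfl⟩ := h
              rfl

/-- Uniform version of `zippel`: if every `degᵢ p ≤ d` then `p` has at least `(#S - d)^n` non-zeros on the
grid `S^n`. -/
theorem zippel_uniform {n : ℕ} (p : MvPolynomial (Fin n) R) (hp : p ≠ 0) (S : Finset R) (d : ℕ)
    (hd : ∀ i, p.degreeOf i ≤ d) :
    (S.card - d) ^ n ≤ ((piFinset fun _ : Fin n => S).filter fun x => ¬ eval x p = 0).card := by
  calc (S.card - d) ^ n = ∏ _i : Fin n, (S.card - d) := by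
        rw [Finset.prod_const, Finset.card_univ, Fintype.card_fin]
    _ ≤ ∏ i : Fin n, (S.card - p.degreeOf i) :=
        Finset.prod_le_prod (fun i _ => Nat.zero_le _) (fun i _ => Nat.sub_le_sub_left (hd i) _)
    _ ≤ _ := zippel p hp (fun _ => S)

/-- The instance of LEMMA ZP: five variables, a six-element evaluation set (the sixth roots of unity in the
memo), individual degrees at most two — at least `4⁵ = 1024` non-zeros. -/
theorem zippel_six_two_five (p : MvPolynomial (Fin 5) R) (hp : p ≠ 0) (S : Finset R) (hS : S.card = 6)
    (hd : ∀ i, p.degreeOf i ≤ 2) :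
    1024 ≤ ((piFinset fun _ : Fin 5 => S).filter fun x => ¬ eval x p = 0).card := by
  have h := zippel_uniform p hp S 2 hd
  rw [hS] at h
  exact h

/-- Pigeonhole through a map with fibres of size at most `m`: a set with more than `m * k` elements has more
than `k` image points. -/
theorem lt_card_image_of_fibre_le {α β : Type*} [DecidableEq β] (s : Finset α) (f : α → β) (m k : ℕ)
    (hfib : ∀ b ∈ s.image f, (s.filter fun a => f a = b).card ≤ m) (hk : m * k < s.card) :
    k < (s.image f).card := by
  have h := Finset.card_le_mul_card_image s m hfib
  by_contra hle
  rw [not_lt] at hle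
  have : m * (s.image f).card ≤ m * k := Nat.mul_le_mul_left _ hle
  omega

/-- THEOREM NP's count: `1024` good points of `μ₆⁵` (fibres of the projection to `G` of size `≤ 6`) give at
least `171` good elements of `G`; numerically `6 * 170 = 1020 < 1024`, and then `Σ_g [P]·[gP] ≤ 21 + 1124 =
1145 < 1242 = 216 + 1026`. -/
theorem np_translate_count {α β : Type*} [DecidableEq β] (s : Finset α) (f : α → β)
    (hfib : ∀ b ∈ s.image f, (s.filter fun a => f a = b).card ≤ 6) (hs : 1024 ≤ s.card) :
    171 ≤ (s.image f).card :=
  lt_card_image_of_fibre_le s f 6 170 hfib (by omega)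

/-- The arithmetic of THEOREM NP / COR NP10 recorded once: `⌈1024/6⌉ = 171`, the self-intersection bound
`21 + (1295 - 171)·1 = 1145`, and the SCREEN threshold `216·1² + 1026·1² = 1242 > 1145`
(equivalently `Q ≤ 929/1296 < 19/24`). -/
theorem np_arithmetic :
    6 * 170 < 1024 ∧ 1024 ≤ 6 * 171 ∧ 21 + (1295 - 171) = 1145 ∧ 216 + 1026 = 1242 ∧ 1145 < 1242 ∧
      (929 : ℚ) / 1296 < 19 / 24 ∧ ((1145 : ℚ) - 216) / 1296 = 929 / 1296 := by
  norm_num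

end SoloBlindZippel

end Summit.HodgeConjecture.HodgeConjecture.Theorems
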